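import Mathlib
import Summits.ValiantsHypothesis.ValiantsHypothesis.Theorems.NewtonUnitEquationsDissociatedUniformStubExposedGenericDirection
import Summits.ValiantsHypothesis.ValiantsHypothesis.Theorems.NewtonUnitEquationsNewtonTauWeakResidueDesignHull

/-!
# `NewtonUnitEquationsNewtonTauWeakClassPrefixHull` — class-prefix hull count for weighted level sets, uniform in the weight values

Registered stub `stub_classPrefixHull` of line `binomial-normal-form` (crux `NewtonTauWeak`,
stmt-ValiantsHypothesis-5904, lead c6, wave 2).

Setting.  Items `j : Fin N` with natural weights `g j ∈ ℕ` (any values, `0` allowed) taking at most `s` distinct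
values (`|g(Fin N)| ≤ s`) and exponents `d j ∈ ℕ²` (coincidences allowed); the weight-`v` level set of subset
sums is `X_v = {Σ_{j ∈ J} d j : Σ_{j ∈ J} g j = v} ⊆ ℕ²`.  Claim: the convex hull of `X_v ⊆ ℝ²` has at most
`(4 N² + 5) (N + 1) ^ s` extreme points — polynomially many in `N`, uniformly in the weight VALUES.

Proof (class normal form; the assembly follows `stub_residueDesignHull` / `stub_weightedLevelSetHullOfNF`).
* (`ClassPrefixHullAux.extremePoint_eq_classPrefix`)  An extreme point `e` of `conv X_v` is strictly exposed by a
  direction `w` (`NewtonUnitEquationsDissociatedUniform.stub_exposedGenericDirection` with `T = ∅`); with the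
  values `c j = ⟨w, d j⟩` the height of `Σ_J d j` is `Σ_J c j`, so `e = Σ_{J₀} d j` for a maximiser `J₀` of
  `Σ_J c j` over `{Σ_J g j = v}`.  CLASS NORMAL FORM: let `n a = |J₀ ∩ g⁻¹ a|` and let `K` consist, for every
  weight class `g⁻¹ a`, of its `n a` items of largest value (in-class rank from the top `< n a`, key `(c j, j)`,
  larger value first, ties by the smaller index).  Class by class `K` has as many items as `J₀`
  (`ClassPrefixHullAux.top_card_and_sum`, from `ResidueNormalFormAux.card_filter_rank_lt` for `-c`), so
  `Σ_K g j = Σ_a a · n a = Σ_{J₀} g j = v` (fibrewise sums), and at least the value of `J₀`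
  (`ResidueNormalFormAux.sum_filter_rank_lt_le` for `-c`); by maximality the values agree, and strict exposure
  forces `Σ_K d j = e`.
* (`ClassPrefixHullAux.classPrefix_eq_of_signs`)  `K` depends on `w` only through `n` and the signs of the
  `N * N` numbers `c j' - c j`, i.e. through the sign vector at `w` of the linear functionals
  `w ↦ ⟨w, d j' - d j⟩` (pairs `(j', j)` enumerated by `finProdFinEquiv`); by
  `ResidueDesignHullAux.signvec_plane_count` at most `4 (N * N) + 5` sign vectors are realised.
* (`stub_classPrefixHull`)  `K` evaluates `n` only at the weights `g j ∈ S := g(Fin N)`, where `n ≤ N`, so `n`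
  may be replaced by the extension by zero of a function `S → Fin (N + 1)`: the extreme points are images of pairs
  (sign vector, `S → Fin (N + 1)`), at most `(4 (N * N) + 5) (N + 1) ^ |S| ≤ (4 (N * N) + 5) (N + 1) ^ s` of them.

Everything is folklore (planar convexity, exchange argument, arrangements on a line, counting); no named facts, no
citations.  No `def`s: the functionals, the sign-canonical set and the zero extension are explicit lambda terms,
introduced as parameters characterised by equations.
-/

-- Sub = Summit single-conjunct layout: the duplicated namespace component is mandated by the tree.
set_option linter.dupNamespace false

noncomputable section

open scoped BigOperators

namespace Summit.ValiantsHypothesis.ValiantsHypothesis.Theorems.NewtonUnitEquationsNewtonTauWeak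

namespace ClassPrefixHullAux

variable {N : ℕ}

/-- **Top sets are largest.**  For `E ⊆ S`, the `|E|` elements of `S` of least rank from the top (key `(c x, x)`:
larger value first, ties by the smaller index) are exactly `|E|` many and have total value `≥ Σ_E c`: this is
`ResidueNormalFormAux.card_filter_rank_lt` / `ResidueNormalFormAux.sum_filter_rank_lt_le` (rank from the bottom)
for the values `-c`. [folklore] -/
theorem top_card_and_sum (S E : Finset (Fin N)) (c : Fin N → ℝ) (hE : E ⊆ S) :
    (S.filter fun x => (S.filter fun z => c x < c z ∨ (c z = c x ∧ z < x)).card < E.card).card = E.card ∧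
      ∑ x ∈ E, c x ≤
        ∑ x ∈ S.filter (fun x => (S.filter fun z => c x < c z ∨ (c z = c x ∧ z < x)).card < E.card), c x := by
  have h1 := ResidueNormalFormAux.card_filter_rank_lt S (fun j => -c j) (Finset.card_le_card hE)
  have h2 := ResidueNormalFormAux.sum_filter_rank_lt_le S (fun j => -c j) hE
  simp only [neg_lt_neg_iff, neg_inj, Finset.sum_neg_distrib, neg_le_neg_iff] at h1 h2
  exact ⟨h1, h2⟩

/-- Sums of the weights are computed fibrewise: `Σ_{j ∈ J} g j = Σ_{a ∈ g(Fin N)} |J ∩ g⁻¹ a| · a`.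
[folklore] -/
theorem sum_weight_fiberwise (g : Fin N → ℕ) (J : Finset (Fin N)) :
    ∑ j ∈ J, g j = ∑ a ∈ Finset.univ.image g, (J.filter fun j => g j = a).card * a := by
  rw [← Finset.sum_fiberwise_of_maps_to' (g := g) (fun j _ => Finset.mem_image_of_mem g (Finset.mem_univ j))
    (fun a => a)]
  exact Finset.sum_congr rfl fun a _ => by rw [Finset.sum_const, smul_eq_mul]

/-- **The class prefix only depends on the sign vector.**  The class-prefix set (in-class rank from the top
`< n (g j)`) compares the values `c` only through the signs of the numbers `c j' - c j`: `c j < c j'` iff the sign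
is `1` and `c j' = c j` iff it is `0`.  Reading these signs from a vector `σ : Fin (N * N) → SignType` (pairs
`(j', j)` via `finProdFinEquiv`), the class-prefix set is the displayed set. [folklore] -/
theorem classPrefix_eq_of_signs (N : ℕ) (g : Fin N → ℕ) (c : Fin N → ℝ) (n : ℕ → ℕ)
    (σ : Fin (N * N) → SignType) (hσ : ∀ j' j, σ (finProdFinEquiv (j', j)) = SignType.sign (c j' - c j)) :
    (Finset.univ.filter fun j : Fin N =>
        (Finset.univ.filter fun j' : Fin N => g j' = g j ∧ (c j < c j' ∨ (c j' = c j ∧ j' < j))).card <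
          n (g j)) =
      Finset.univ.filter fun j : Fin N =>
        (Finset.univ.filter fun j' : Fin N => g j' = g j ∧
          (σ (finProdFinEquiv (j', j)) = 1 ∨ (σ (finProdFinEquiv (j', j)) = 0 ∧ j' < j))).card < n (g j) := by
  simp only [hσ, sign_eq_one_iff, sign_eq_zero_iff, sub_pos, sub_eq_zero]

/-- **Every vertex is the point of a class prefix.**  Every extreme point `e` of the convex hull of
`X_v = {Σ_{j ∈ J} d j : Σ_{j ∈ J} g j = v}` is `Σ_{j ∈ K} d j` for the class-prefix set `K` (in-class rank from
the top `< n (g j)` for the key `(c j, j)`) of the values `c j = ⟨w, d j⟩` of a strictly exposing direction `w`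
(`stub_exposedGenericDirection`) and class sizes `n a ≤ N`: `e = Σ_{J₀} d j` with `J₀` of weight `v` maximising
`Σ_J c j` among sets of weight `v` (heights of subset sums are sums of values); with `n a = |J₀ ∩ g⁻¹ a|` the
set `K` meets every class in as many items as `J₀` (so it has weight `v`) and of at least the same total value
(`top_card_and_sum`), hence it is a maximiser too, and a strictly exposed maximum is attained at `e` only.
[folklore] -/
theorem extremePoint_eq_classPrefix (N v : ℕ) (g : Fin N → ℕ) (d : Fin N → (Fin 2 →₀ ℕ))
    (e : Fin 2 → ℝ)
    (he : e ∈ Set.extremePoints ℝ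
      (convexHull ℝ ((fun e : Fin 2 →₀ ℕ => fun i : Fin 2 => ((e i : ℕ) : ℝ)) ''
        (((Finset.univ.filter fun J : Finset (Fin N) => ∑ j ∈ J, g j = v).image
          fun J => ∑ j ∈ J, d j : Finset (Fin 2 →₀ ℕ)) : Set (Fin 2 →₀ ℕ))))) :
    ∃ (w : Fin 2 → ℝ) (c : Fin N → ℝ) (n : ℕ → ℕ),
      (∀ j, c j = ∑ i, w i * ((d j i : ℕ) : ℝ)) ∧ (∀ a, n a ≤ N) ∧
      e = fun i => (((∑ j ∈ (Finset.univ.filter fun j : Fin N =>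
          (Finset.univ.filter fun j' : Fin N => g j' = g j ∧ (c j < c j' ∨ (c j' = c j ∧ j' < j))).card <
            n (g j)), d j) i : ℕ) : ℝ) := by
  classical
  obtain ⟨w, e₀, he₀X, rfl, hexp, -⟩ :=
    NewtonUnitEquationsDissociatedUniform.stub_exposedGenericDirection _ ∅ e he
  obtain ⟨c, hc⟩ : ∃ c : Fin N → ℝ, ∀ j, c j = ∑ i, w i * ((d j i : ℕ) : ℝ) := ⟨_, fun _ => rfl⟩
  -- heights of subset sums are sums of values
  have hlin : ∀ J : Finset (Fin N), ∑ i, w i * (((∑ j ∈ J, d j) i : ℕ) : ℝ) = ∑ j ∈ J, c j := by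
    intro J
    simp only [Finsupp.finsetSum_apply, Nat.cast_sum, Finset.mul_sum, hc]
    exact Finset.sum_comm
  -- the exposed vertex is a subset sum of weight `v` and maximal value
  obtain ⟨J₀, hJ₀, rfl⟩ := Finset.mem_image.1 he₀X
  have hJ₀v : ∑ j ∈ J₀, g j = v := (Finset.mem_filter.1 hJ₀).2
  have hmax : ∀ J' : Finset (Fin N), ∑ j ∈ J', g j = v → ∑ j ∈ J', c j ≤ ∑ j ∈ J₀, c j := by
    intro J' hJ'
    by_cases heq : ∑ j ∈ J', d j = ∑ j ∈ J₀, d j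
    · exact le_of_eq (by rw [← hlin, ← hlin, heq])
    · have hlt := hexp _ (Finset.mem_image.2 ⟨J', Finset.mem_filter.2 ⟨Finset.mem_univ _, hJ'⟩, rfl⟩) heq
      rw [hlin, hlin] at hlt
      exact hlt.le
  -- a maximiser's point is the vertex, by strict exposure
  have huniq : ∀ K : Finset (Fin N), ∑ j ∈ K, g j = v → ∑ j ∈ K, c j = ∑ j ∈ J₀, c j →
      (fun i : Fin 2 => (((∑ j ∈ J₀, d j) i : ℕ) : ℝ)) = fun i => (((∑ j ∈ K, d j) i : ℕ) : ℝ) := by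
    intro K hK hKsum
    by_contra hne
    have hne' : ∑ j ∈ K, d j ≠ ∑ j ∈ J₀, d j := fun h => hne (by rw [h])
    have hlt := hexp _ (Finset.mem_image.2 ⟨K, Finset.mem_filter.2 ⟨Finset.mem_univ _, hK⟩, rfl⟩) hne'
    rw [hlin, hlin, hKsum] at hlt
    exact lt_irrefl _ hlt
  -- the class sizes of `J₀` and the class-prefix set `K`
  obtain ⟨n, hn⟩ : ∃ n : ℕ → ℕ, ∀ a, n a = (J₀.filter fun j => g j = a).card := ⟨_, fun _ => rfl⟩
  obtain ⟨K, hK⟩ : ∃ K : Finset (Fin N), K = Finset.univ.filter fun j : Fin N =>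
      (Finset.univ.filter fun j' : Fin N => g j' = g j ∧ (c j < c j' ∨ (c j' = c j ∧ j' < j))).card <
        n (g j) := ⟨_, rfl⟩
  -- the classes of `K` are the top sets of the classes, of the sizes of the classes of `J₀`
  have hfib : ∀ a, K.filter (fun j => g j = a) =
      (Finset.univ.filter fun z : Fin N => g z = a).filter fun x =>
        ((Finset.univ.filter fun z : Fin N => g z = a).filter fun z => c x < c z ∨ (c z = c x ∧ z < x)).card <
          (J₀.filter fun j => g j = a).card := by
    intro a
    ext j
    simp only [hK, hn, Finset.filter_filter, Finset.mem_filter, Finset.mem_univ, true_and]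
    constructor
    · rintro ⟨h, rfl⟩
      exact ⟨rfl, h⟩
    · rintro ⟨rfl, h⟩
      exact ⟨h, rfl⟩
  have hcls : ∀ a, (K.filter fun j => g j = a).card = (J₀.filter fun j => g j = a).card ∧
      ∑ j ∈ J₀.filter (fun j => g j = a), c j ≤ ∑ j ∈ K.filter (fun j => g j = a), c j := by
    intro a
    rw [hfib]
    exact top_card_and_sum _ _ c (Finset.filter_subset_filter _ (Finset.subset_univ J₀))
  -- so `K` has weight `v` and maximal value
  have hKv : ∑ j ∈ K, g j = v := by
    rw [← hJ₀v, sum_weight_fiberwise, sum_weight_fiberwise]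
    exact Finset.sum_congr rfl fun a _ => by rw [(hcls a).1]
  have hKsum : ∑ j ∈ K, c j = ∑ j ∈ J₀, c j := by
    refine le_antisymm (hmax K hKv) ?_
    rw [← Finset.sum_fiberwise_of_maps_to (s := J₀) (t := Finset.univ.image g) (g := g)
        (fun j _ => Finset.mem_image_of_mem g (Finset.mem_univ j)),
      ← Finset.sum_fiberwise_of_maps_to (s := K) (t := Finset.univ.image g) (g := g)
        (fun j _ => Finset.mem_image_of_mem g (Finset.mem_univ j))]
    exact Finset.sum_le_sum fun a _ => (hcls a).2
  refine ⟨w, c, n, hc, fun a => ?_, ?_⟩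
  · rw [hn]
    exact (Finset.card_filter_le _ _).trans ((Finset.card_le_univ J₀).trans_eq (Fintype.card_fin N))
  · rw [← hK]
    exact huniq K hKv hKsum

end ClassPrefixHullAux

/-- **Class-prefix hull count (hull vertices of weighted level sets, uniform in the weight values), registered
stub `stub_classPrefixHull` of line `binomial-normal-form`.**  For natural weights `g j` taking at most `s`
distinct values and exponents `d j ∈ ℕ²` (`j : Fin N`, coincidences allowed), the convex hull of
`X_v = {Σ_{j ∈ J} d j : Σ_{j ∈ J} g j = v}` has at most `(4 (N * N) + 5) (N + 1) ^ s` extreme points.  Proof: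
every extreme point is `Σ_{j ∈ K} d j` for the class-prefix set `K` of the values `c` of a strictly exposing
direction `w` and class sizes `n ≤ N` (`ClassPrefixHullAux.extremePoint_eq_classPrefix`); `K` is determined by
`n` restricted to the weight values `g(Fin N)` (a function `g(Fin N) → Fin (N + 1)`, `(N + 1) ^ |g(Fin N)|` of
them) and by the sign vector of the `N * N` functionals `⟨w, d j' - d j⟩`
(`ClassPrefixHullAux.classPrefix_eq_of_signs`), at most `4 (N * N) + 5` of them
(`ResidueDesignHullAux.signvec_plane_count`). [folklore] -/
theorem stub_classPrefixHull (N v s : ℕ) (g : Fin N → ℕ) (hs : (Finset.univ.image g).card ≤ s)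
    (d : Fin N → (Fin 2 →₀ ℕ)) :
    (Set.extremePoints ℝ (convexHull ℝ ((fun e : Fin 2 →₀ ℕ => fun i : Fin 2 => ((e i : ℕ) : ℝ)) ''
      (((Finset.univ.filter fun J : Finset (Fin N) => ∑ j ∈ J, g j = v).image
        fun J => ∑ j ∈ J, d j : Finset (Fin 2 →₀ ℕ)) : Set (Fin 2 →₀ ℕ))))).ncard ≤
      (4 * (N * N) + 5) * (N + 1) ^ s := by
  classical
  -- the `N * N` linear functionals `w ↦ ⟨w, d j' - d j⟩`, pairs `(j', j)` via `finProdFinEquiv`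
  obtain ⟨u, hup⟩ : ∃ u : Fin (N * N) → Fin 2 → ℝ, ∀ j' j i, u (finProdFinEquiv (j', j)) i =
      ((d j' i : ℕ) : ℝ) - ((d j i : ℕ) : ℝ) := by
    refine ⟨fun p i =>
      ((d (finProdFinEquiv.symm p).1 i : ℕ) : ℝ) - ((d (finProdFinEquiv.symm p).2 i : ℕ) : ℝ), fun j' j i => ?_⟩
    simp only [Equiv.symm_apply_apply]
  -- the class-prefix set read off from a sign vector and the class sizes
  obtain ⟨F, hF⟩ : ∃ F : (Fin (N * N) → SignType) → (ℕ → ℕ) → Finset (Fin N), ∀ σ n,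
      F σ n = Finset.univ.filter fun j : Fin N =>
        (Finset.univ.filter fun j' : Fin N => g j' = g j ∧
          (σ (finProdFinEquiv (j', j)) = 1 ∨ (σ (finProdFinEquiv (j', j)) = 0 ∧ j' < j))).card < n (g j) :=
    ⟨_, fun _ _ => rfl⟩
  -- the zero extension `ℕ → ℕ` of a function on the weight values
  obtain ⟨L, hL⟩ : ∃ L : ({a : ℕ // a ∈ Finset.univ.image g} → Fin (N + 1)) → ℕ → ℕ, ∀ ν a,
      L ν a = if h : a ∈ Finset.univ.image g then ((ν ⟨a, h⟩ : Fin (N + 1)) : ℕ) else 0 :=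
    ⟨_, fun _ _ => rfl⟩
  -- the realised sign vectors
  obtain ⟨V, hV⟩ : ∃ V : Set (Fin (N * N) → SignType),
      V = {v | ∃ w : Fin 2 → ℝ, v = fun m => SignType.sign (∑ i, w i * u m i)} := ⟨_, rfl⟩
  have hVcard : V.ncard ≤ 4 * (N * N) + 5 := by
    rw [hV]
    exact ResidueDesignHullAux.signvec_plane_count _ u
  -- every vertex is the point of the class prefix of a realised sign vector and class sizes `≤ N`
  refine (Set.ncard_le_ncard (t :=
    (fun p : (Fin (N * N) → SignType) × ({a : ℕ // a ∈ Finset.univ.image g} → Fin (N + 1)) =>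
      fun i : Fin 2 => (((∑ j ∈ F p.1 (L p.2), d j) i : ℕ) : ℝ)) ''
        (V ×ˢ (Set.univ : Set ({a : ℕ // a ∈ Finset.univ.image g} → Fin (N + 1))))) ?_).trans ?_
  · intro e he
    obtain ⟨w, c, n, hc, hn, he_eq⟩ := ClassPrefixHullAux.extremePoint_eq_classPrefix N v g d e he
    -- the sign vector at `w` records the signs of `c j' - c j`
    have hvp : ∀ j' j, SignType.sign (∑ i, w i * u (finProdFinEquiv (j', j)) i) =
        SignType.sign (c j' - c j) := fun j' j => by
      simp only [hup, hc, mul_sub, Finset.sum_sub_distrib]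
    have hAeq := ClassPrefixHullAux.classPrefix_eq_of_signs N g c n
      (fun m => SignType.sign (∑ i, w i * u m i)) hvp
    -- the class sizes are only evaluated at the weight values
    have hLn : ∀ j, L (fun a => ⟨n a.1, Nat.lt_succ_of_le (hn a.1)⟩) (g j) = n (g j) := fun j => by
      rw [hL, dif_pos (Finset.mem_image_of_mem g (Finset.mem_univ j))]
    refine ⟨((fun m => SignType.sign (∑ i, w i * u m i)), fun a => ⟨n a.1, Nat.lt_succ_of_le (hn a.1)⟩),
      Set.mk_mem_prod (by rw [hV]; exact ⟨w, rfl⟩) (Set.mem_univ _), ?_⟩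
    dsimp only
    have hFeq : F (fun m => SignType.sign (∑ i, w i * u m i)) (L fun a => ⟨n a.1, Nat.lt_succ_of_le (hn a.1)⟩) =
        F (fun m => SignType.sign (∑ i, w i * u m i)) n := by
      rw [hF, hF]
      exact Finset.filter_congr fun j _ => by rw [hLn]
    rw [hFeq, hF, ← hAeq]
    exact he_eq.symm
  -- count
  · calc _ ≤ (V ×ˢ (Set.univ : Set ({a : ℕ // a ∈ Finset.univ.image g} → Fin (N + 1)))).ncard :=
          Set.ncard_image_le
      _ = V.ncard * (N + 1) ^ (Finset.univ.image g).card := by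
          rw [Set.ncard_prod, Set.ncard_univ, Nat.card_fun, Nat.card_fin, Nat.card_eq_finsetCard]
      _ ≤ (4 * (N * N) + 5) * (N + 1) ^ s :=
          Nat.mul_le_mul hVcard (Nat.pow_le_pow_right (Nat.succ_pos N) hs)

end Summit.ValiantsHypothesis.ValiantsHypothesis.Theorems.NewtonUnitEquationsNewtonTauWeak

end
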